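import Summits.MatrixMultiplication.OmegaCensus.BoxUsefulOddSylowAbelian

/-!
# ω-census, family (b3): conjecture C9 (b) on NILPOTENT groups reduces to `2`-groups — odd-order elements of a box-useful nilpotent group are central

HONEST FRAMING (pub-omega census; verbatim): lottery ticket; floor = certified bounds/negative ranges.
Census BOOKKEEPING (conjecture C9 of the cell, STRUCTURE.md §2; pub-omega kernel-l4 gen 15, task K-4).  `BoxUsefulOddSylowAbelian`
(gen 14) proved that the odd Sylow subgroups of a box-useful finite group are abelian and that C9 (b) holds on nilpotent groups of ODD
order.  This file removes the parity hypothesis as far as the odd part goes: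
* **`mul_comm_of_odd_orderOf`** / **`mem_center_of_odd_orderOf`**: in a box-useful finite NILPOTENT group every element of odd
  order is CENTRAL (through Mathlib's Sylow direct-product decomposition `Group.isNilpotent_of_finite_tfae`: componentwise, odd
  Sylow components commute because odd Sylows are abelian (`OddPGroup.sylow_comm_of_boxUseful`), and the `2`-component of an
  odd-order element is trivial);
* **`odd_sylow_le_center`**: every Sylow `p`-subgroup, `p` odd, lies in the centre;
* **`isPGroup_two_quotient_center`** / **`index_center_eq_two_pow`**: `G ⧸ Z(G)` is a `2`-group, `[G : Z(G)] = 2^k`.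
So for nilpotent groups C9 (b) («box-useful ⇒ centre index `1`, `4`, `6` or `𝒞₂`») is EXACTLY the `2`-group statement «a box-useful
`2`-group has centre index `1` or `4`» (index `6` and `𝒞₂` are not nilpotent shapes), whose minimal test objects are the subject of
`DihedralModular` / `C2CubeExtension` / `C4SquareExtension` / `BoxBadOrder64MinimalA`.  Nothing here is progress on `ω`.
-/

namespace Summit.MatrixMultiplication.OmegaCensus

open Finset ProductBoxBound

namespace BoxNilpotent

variable {G : Type*} [Group G] [Fintype G] [DecidableEq G]

/-- In a `q`-group with `q` a prime that is not odd (so `q = 2`), an element of odd order is trivial. [folklore] -/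
theorem eq_one_of_odd_orderOf {q : ℕ} [hq : Fact q.Prime] (hqo : ¬ Odd q) {H : Type*} [Group H] (hH : IsPGroup q H)
    {h : H} (hodd : Odd (orderOf h)) : h = 1 := by
  obtain ⟨k, hk⟩ := IsPGroup.iff_orderOf.mp hH h
  have hq2 : q = 2 := (hq.out.eq_two_or_odd').resolve_right hqo
  subst hq2
  cases k with
  | zero => rw [pow_zero] at hk; exact orderOf_eq_one_iff.mp hk
  | succ k =>
    exfalso
    rw [hk, pow_succ] at hodd
    exact (Nat.not_even_iff_odd.mpr hodd) (even_two.mul_left _)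

/-- **In a box-useful finite nilpotent group, an element of odd order commutes with everything.**  Componentwise in the Sylow
direct product: odd Sylow subgroups are abelian (`OddPGroup.sylow_comm_of_boxUseful`), and the `2`-component of an odd-order element
is trivial. [folklore] -/
theorem mul_comm_of_odd_orderOf [Group.IsNilpotent G] (hG : BoxUseful G) {x : G} (hx : Odd (orderOf x)) (y : G) :
    x * y = y * x := by
  classical
  obtain ⟨e⟩ := ((Group.isNilpotent_of_finite_tfae (G := G)).out 0 4 rfl rfl).mp ‹_›
  have hpow : (e.symm x) ^ orderOf x = 1 := by rw [← map_pow, pow_orderOf_eq_one, map_one]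
  have key : e.symm x * e.symm y = e.symm y * e.symm x := by
    funext q P
    haveI : Fact (Nat.Prime (q : ℕ)) := ⟨Nat.prime_of_mem_primeFactors q.2⟩
    apply Subtype.ext
    simp only [Pi.mul_apply, Subgroup.coe_mul]
    by_cases hqo : Odd (q : ℕ)
    · exact OddPGroup.sylow_comm_of_boxUseful hqo hG P _ _ ((e.symm x) q P).2 ((e.symm y) q P).2
    · have h2 : ((e.symm x) q P) ^ orderOf x = 1 := by
        have := congrFun (congrFun hpow q) P
        simpa only [Pi.pow_apply, Pi.one_apply] using this
      have h1 : (e.symm x) q P = 1 :=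
        eq_one_of_odd_orderOf hqo P.isPGroup' (hx.of_dvd_nat (orderOf_dvd_of_pow_eq_one h2))
      rw [h1, Subgroup.coe_one, one_mul, mul_one]
  simpa using congrArg e key

/-- **Odd-order elements of a box-useful finite nilpotent group are central.** [folklore] -/
theorem mem_center_of_odd_orderOf [Group.IsNilpotent G] (hG : BoxUseful G) {x : G} (hx : Odd (orderOf x)) :
    x ∈ Subgroup.center G :=
  Subgroup.mem_center_iff.mpr fun y => (mul_comm_of_odd_orderOf hG hx y).symm

/-- **Every Sylow `p`-subgroup with `p` odd of a box-useful finite nilpotent group is central.** [folklore] -/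
theorem odd_sylow_le_center [Group.IsNilpotent G] (hG : BoxUseful G) {p : ℕ} [hp : Fact p.Prime] (hodd : Odd p)
    (P : Sylow p G) : (P : Subgroup G) ≤ Subgroup.center G := by
  intro a ha
  obtain ⟨k, hk⟩ := IsPGroup.iff_orderOf.mp P.isPGroup' ⟨a, ha⟩
  rw [Subgroup.orderOf_mk] at hk
  exact mem_center_of_odd_orderOf hG (hk ▸ hodd.pow)

/-- **The central quotient of a box-useful finite nilpotent group is a `2`-group.** [folklore] -/
theorem isPGroup_two_quotient_center [Group.IsNilpotent G] (hG : BoxUseful G) : IsPGroup 2 (G ⧸ Subgroup.center G) := by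
  intro q
  induction q using QuotientGroup.induction_on with
  | H g =>
    obtain ⟨k, m, hm, hn⟩ := Nat.exists_eq_two_pow_mul_odd (orderOf_pos g).ne'
    refine ⟨k, ?_⟩
    rw [← QuotientGroup.mk_pow, QuotientGroup.eq_one_iff]
    apply mem_center_of_odd_orderOf hG
    have h2k : (2 : ℕ) ^ k ≠ 0 := pow_ne_zero k two_ne_zero
    rw [orderOf_pow' g h2k, hn, Nat.gcd_eq_right (dvd_mul_right (2 ^ k) m), Nat.mul_div_cancel_left m (Nat.pos_of_ne_zero h2k)]
    exact hm

/-- **`[G : Z(G)]` is a power of `2`** for a box-useful finite nilpotent group. [folklore] -/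
theorem index_center_eq_two_pow [Group.IsNilpotent G] (hG : BoxUseful G) : ∃ k : ℕ, (Subgroup.center G).index = 2 ^ k := by
  haveI : Fact (Nat.Prime 2) := ⟨Nat.prime_two⟩
  obtain ⟨k, hk⟩ := (isPGroup_two_quotient_center hG).exists_card_eq
  exact ⟨k, by rw [Subgroup.index_eq_card, hk]⟩

end BoxNilpotent

end Summit.MatrixMultiplication.OmegaCensus
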